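import Literature.AlgebraicGeometry.Frobenioids.PerfectionPullbackClasses
import Literature.AlgebraicGeometry.Frobenioids.PerfectionFrobeniusArrows
import Literature.AlgebraicGeometry.Frobenioids.PreFrobenioidDataToFunctor
import HarnessLib

/-!
# Frobenioids I, Proposition 3.2 (iii) "`C^pf` is a Frobenioid": Definition 1.3 (iv)(a) for the perfection —
# uniqueness of the factorization pull-back ∘ pre-step ∘ Frobenius-type (PROOFS)

Mochizuki, *The geometry of Frobenioids I: the general theory*, Kyushu J. Math. **62** (2008)
293–400, Definition 1.3 (iv)(a) p. 24, Proposition 3.2 (iii) p. 59 [cite: MochizukiFrdI2008, Prop. 3.2 (iii) p.59].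

PROOF-ONLY piece of the row «`C^pf` is a Frobenioid» (row `FrdI:Prop3.2(iii)-frobenioid`, carve-up v2,
L1-lead R99 (2): Def. 1.3 (iv)/(vi) for `Perfection.ops hF`, seat abc-iut-w5-d246), for `C` of
Frobenius-isotropic type (`hiso`, print's standing hypothesis of §3), sequel of
`PerfectionFactorization.lean` (existence, `iv_a_exists_perfection`):

* `iv_a_unique_perfection`: two factorizations `γ ≫ β ≫ α = φ = γ′ ≫ β′ ≫ α′` of an arrow of `C^pf`
  (`γ, γ′` of Frobenius type, `β, β′` pre-steps, `α, α′` pull-back morphisms) are related by isomorphisms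
  `ε : P ≅ P′`, `δ : Q ≅ Q′` with `γ ≫ ε = γ′`, `β ≫ δ = ε ≫ β′`, `α = δ ≫ α′`.  Argument (intrinsic to
  `C^pf`): the base map `Base(γ ≫ β)⁻¹ ≫ Base(γ′ ≫ β′)` lies over `Base α ↦ Base α′`, so the pull-back
  property of `α′` lifts it to `δ : Q → Q′` with `δ ≫ α′ = α` — a pull-back morphism (two-out-of-three)
  and a base-isomorphism, hence an isomorphism (Remark 1.2.1 for the structure functor `(ops hF).toFunctor`) — and its
  uniqueness half forces
  `γ ≫ β ≫ δ = γ′ ≫ β′`; comparing Frobenius degrees (pre-steps and isomorphisms are linear) gives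
  `deg_Fr γ = deg_Fr γ′`, so Def. 1.3 (ii) of `C^pf` (`ii_unique_perfection`) yields `ε : P ≅ P′` under
  `X`, and `ε ≫ β′ = β ≫ δ` because `γ` is an epimorphism (`C^pf` is totally epimorphic).
No new definitions; nothing here is specific to the abc programme.
-/

namespace Literature.AlgebraicGeometry.Frobenioids

namespace PreFrobenioid

namespace Perfection

open CategoryTheory Opposite

universe w v v' u u'

variable {D : Type u} [Category.{v} D] {Φ : Dᵒᵖ ⥤ CommMonCat.{w}}
  {C : Type u'} [Category.{v'} C] {F : C ⥤ ElemFrobenioid Φ} {hF : IsFrobenioid F}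

/-! ### Comparison of two pull-back morphisms over a common target -/

/-- **Pull-back morphisms over a common arrow are compared by an isomorphism.**  If `u ≫ α = φ = u′ ≫ α′`
in `C^pf` with `u, u′` base-isomorphisms and `α, α′` pull-back morphisms, then there is an isomorphism
`δ : Q ≅ Q′` with `δ ≫ α′ = α` and `u ≫ δ = u′` (the pull-back property of `α′` applied to the base map
`Base(u)⁻¹ ≫ Base(u′)`; Remark 1.2.1). [cite: MochizukiFrdI2008, Rem. 1.2.1 p.22] -/
theorem exists_iso_of_isPullbackMorphism_pair ⦃X Y Q Q' : Perfection hF⦄ (φ : X ⟶ Y) (u : X ⟶ Q)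
    (α : Q ⟶ Y) (u' : X ⟶ Q') (α' : Q' ⟶ Y) (h : u ≫ α = φ) (hu : (ops hF).IsBaseIso u)
    (hα : (ops hF).IsPullbackMorphism α) (h' : u' ≫ α' = φ) (hu' : (ops hF).IsBaseIso u')
    (hα' : (ops hF).IsPullbackMorphism α') :
    ∃ δ : Q ≅ Q', δ.hom ≫ α' = α ∧ u ≫ δ.hom = u' := by
  haveI : IsIso ((ops hF).base.map u) := hu
  haveI : IsIso ((ops hF).base.map u') := hu'
  -- the base map `k : Base Q → Base Q′` over `Base α ↦ Base α′`
  let k : (ops hF).base.obj Q ⟶ (ops hF).base.obj Q' := inv ((ops hF).base.map u) ≫ (ops hF).base.map u'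
  have hφ : (ops hF).base.map u ≫ (ops hF).base.map α = (ops hF).base.map u' ≫ (ops hF).base.map α' := by
    rw [← Functor.map_comp, ← Functor.map_comp, h, h']
  have hk : k ≫ (ops hF).base.map α' = (ops hF).base.map α := by
    change (inv ((ops hF).base.map u) ≫ (ops hF).base.map u') ≫ _ = _
    rw [Category.assoc, ← hφ, IsIso.inv_hom_id_assoc]
  -- lift `k` along the pull-back morphism `α′`
  obtain ⟨δ, ⟨hδ₁, hδ₂⟩, -⟩ := hα' α k hk
  -- `δ` is a pull-back morphism and a base-isomorphism, hence an isomorphism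
  have hδpb : (ops hF).IsPullbackMorphism δ :=
    PreFrobenioidData.IsPullbackMorphism.of_comp hα' (by rw [hδ₁]; exact hα)
  have hδbi : (ops hF).IsBaseIso δ := by
    change IsIso ((ops hF).base.map δ)
    rw [hδ₂]
    infer_instance
  haveI : IsIso δ := (isPullbackMorphism_and_isBaseIso_iff_isIso (ops hF).toFunctor δ).mp
    ⟨(PreFrobenioidData.ofFunctor_isPullbackMorphism (ops hF).toFunctor δ).mp hδpb, hδbi⟩
  -- `u ≫ δ = u′` by the uniqueness half of the pull-back property of `α′`
  have hb' : (ops hF).base.map u' ≫ (ops hF).base.map α' = (ops hF).base.map φ := by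
    rw [← Functor.map_comp, h']
  obtain ⟨ψ, -, huniq⟩ := hα' φ ((ops hF).base.map u') hb'
  have e₁ : u ≫ δ = ψ := huniq (u ≫ δ) ⟨by rw [Category.assoc, hδ₁, h], by
    rw [Functor.map_comp, hδ₂]
    change (ops hF).base.map u ≫ inv ((ops hF).base.map u) ≫ (ops hF).base.map u' = _
    rw [IsIso.hom_inv_id_assoc]⟩
  have e₂ : u' = ψ := huniq u' ⟨h', rfl⟩
  exact ⟨asIso δ, hδ₁, e₁.trans e₂.symm⟩

/-! ### Definition 1.3 (iv)(a), uniqueness -/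

/-- **Def. 1.3 (iv)(a) for `C^pf`, uniqueness** (for `C` of Frobenius-isotropic type): two factorizations
`γ ≫ β ≫ α = φ = γ′ ≫ β′ ≫ α′` of an arrow of `C^pf` as (Frobenius type) ≫ (pre-step) ≫ (pull-back
morphism) are related by isomorphisms `ε : P ≅ P′`, `δ : Q ≅ Q′`: `γ ≫ ε = γ′`, `β ≫ δ = ε ≫ β′`,
`α = δ ≫ α′`. [cite: MochizukiFrdI2008, Prop. 3.2 (iii) p.59] -/
theorem iv_a_unique_perfection (hiso : IsOfType (IsFrobeniusIsotropic F))
    ⦃X Y P Q P' Q' : Perfection hF⦄ (φ : X ⟶ Y) (γ : X ⟶ P) (β : P ⟶ Q) (α : Q ⟶ Y)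
    (γ' : X ⟶ P') (β' : P' ⟶ Q') (α' : Q' ⟶ Y)
    (h : γ ≫ β ≫ α = φ) (hγ : (ops hF).IsFrobeniusType γ) (hβ : (ops hF).IsPreStep β)
    (hα : (ops hF).IsPullbackMorphism α)
    (h' : γ' ≫ β' ≫ α' = φ) (hγ' : (ops hF).IsFrobeniusType γ') (hβ' : (ops hF).IsPreStep β')
    (hα' : (ops hF).IsPullbackMorphism α') :
    ∃ (ε : P ≅ P') (δ : Q ≅ Q'), γ ≫ ε.hom = γ' ∧ β ≫ δ.hom = ε.hom ≫ β' ∧ α = δ.hom ≫ α' := by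
  -- `γ ≫ β`, `γ′ ≫ β′` are base-isomorphisms
  have hu : (ops hF).IsBaseIso (γ ≫ β) := by
    haveI : IsIso ((ops hF).base.map γ) := hγ.2
    haveI : IsIso ((ops hF).base.map β) := hβ.2
    change IsIso ((ops hF).base.map (γ ≫ β))
    rw [Functor.map_comp]
    infer_instance
  have hu' : (ops hF).IsBaseIso (γ' ≫ β') := by
    haveI : IsIso ((ops hF).base.map γ') := hγ'.2
    haveI : IsIso ((ops hF).base.map β') := hβ'.2
    change IsIso ((ops hF).base.map (γ' ≫ β'))
    rw [Functor.map_comp]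
    infer_instance
  -- the isomorphism `δ` of the pull-back parts
  obtain ⟨δ, hδα, hδ⟩ := exists_iso_of_isPullbackMorphism_pair φ (γ ≫ β) α (γ' ≫ β') α'
    (by rw [Category.assoc, h]) hu hα (by rw [Category.assoc, h']) hu' hα'
  -- Frobenius degrees: `deg_Fr γ = deg_Fr γ′`
  have hdeg : (ops hF).degFr γ = (ops hF).degFr γ' := by
    have e := congrArg (ops hF).degFr hδ
    rw [(ops hF).degFr_comp, (ops hF).degFr_comp, (ops hF).degFr_comp, show (ops hF).degFr β = 1 from hβ.1,
      show (ops hF).degFr β' = 1 from hβ'.1, degFr_eq_one_of_isIso δ.hom, mul_one, mul_one, mul_one] at e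
    exact e
  -- Def. 1.3 (ii) of `C^pf`: the isomorphism `ε` of the Frobenius-type parts
  obtain ⟨ε, hε⟩ := ii_unique_perfection hF hiso γ γ' hγ hγ' hdeg
  refine ⟨ε, δ, hε, ?_, hδα.symm⟩
  -- `β ≫ δ = ε ≫ β′` since `γ` is an epimorphism
  haveI := epi_hom γ
  rw [← cancel_epi γ, ← Category.assoc, hδ, ← Category.assoc, hε]

end Perfection

end PreFrobenioid

end Literature.AlgebraicGeometry.Frobenioids
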